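import Literature.AlgebraicGeometry.HodgeTheory.BettiHardLefschetzHodgeMorphisms
import Literature.AlgebraicGeometry.HodgeTheory.BettiSelfProductExceptionalHodgeClasses
import HarnessLib

/-!
# The middle cohomology of the self-product: `dim_ℚ Hdgⁿ(H^{2n}(X × X)) = Σ_{i+j=2n} dim_ℚ End_HS(H^{min(i,j)}(X)) = dim End_HS(Hⁿ(X)) + 2 Σ_{k<n} dim End_HS(Hᵏ(X))`,
# the Künneth components `δ_i` of the diagonal as a lower bound, `ρ(C × C) = 2 + dim End_HS(H¹(C))`, and the exceptional classes of `X × X` in the middle degree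
# (Voisin I §11.3.3 Thm. 11.40 / Lemma 11.41 / p. 287 with hard Lefschetz Thm. 6.25)

Family `hodge`, lane `lit-hodgefound` (Track 2 foundations library; Layers A1/A4), layer `Literature/AlgebraicGeometry/HodgeTheory`.  THEOREMS ONLY (no definition,
no named fact, no instance; D-0026 net debt `0`).  Sequel of the seat's g28-#1 (`BettiHardLefschetzHodgeMorphisms`: `Lᵗ : Hᵏ(X) ⥲ H^{k+2t}(X)(t)` for `k + t = n` and the transport of
`Hom_HS` spaces) and g28-#2 (`BettiSelfProductExceptionalHodgeClasses`: `End_HS(Hᵏ(X))` versus products of Hodge classes, the same-degree pieces `Hᵏ ⊗ Hᵏ`).  Voisin places the class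
`δ_i` given by `Id_i` in the piece `H^{2n−i}(X) ⊗ Hⁱ(X)` of the MIDDLE degree `H^{2n}(X × X)` (Thm. 11.40: `Hᵏ(X) ⊗ Hˡ(Y) ≅ Hom(H^{2n−k}(X), Hˡ(Y))` by Poincaré duality, `Σ_i δ_i = [Δ_X]`).
On the lane's carriers (Lemma 11.41 through a polarization of the first factor, g27-#7) the piece `Hⁱ(X) ⊗ H^{2n−i}(X)` has `dim Hdgⁿ = dim Hom_HS(Hⁱ(X), H^{2n−i}(X)(n − i))`, and hard Lefschetz
`Hⁱ(X) ≅ H^{2n−i}(X)(n − i)` (g28-#1) turns this into `dim End_HS(H^{min(i, 2n−i)}(X))`.  Summing over the Künneth decomposition (g27-#1) gives the displayed count; every non-zero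
`Hⁱ(X)`, `i ≤ 2n`, contributes at least its `δ_i` (so `#{i ≤ 2n : b_i(X) ≠ 0} ≤ dim_ℚ Hdgⁿ(H^{2n}(X × X))`), and g27-#1's product count `Σ_{a+b=n} dim Hdgᵃ(X) dim Hdgᵇ(X)` is STRICTLY
smaller as soon as `X` has a non-zero odd Betti number or a non-pure `H^{2a}(X)`, `2a ≤ n` (g28-#2's dichotomy in the middle degree).

THE PRINTS.  C. Voisin (2002) [VoisinHodgeI2002] §11.3.3 Thm. 11.38 (p. 285), Thm. 11.40, Lemma 11.41 (p. 286), p. 287 («the morphisms of Hodge structures given by the identity `Id_k : Hᵏ(X, ℤ) →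
Hᵏ(X, ℤ)` … provide Hodge classes `δ_k` of degree `2n` on `X × X` … `Σ_k δ_k` is equal to the cohomology class of the diagonal of `X` in `X × X`»); §6.2.3 Thm. 6.25, §7.1.2 (hard Lefschetz
over `ℚ`).  S. Kleiman (1968) [Kleiman1968AlgebraicCycles] §1.4 (the Künneth components `πᵢ` of `Δ`; conjecture `C(X)`).  D. Arapura (2012) [Arapura2012] §11.1 Example 11.1.2 (`ρ(C × C')`).
K. Hulek, R. Laface (2019) [HulekLaface2019PicardNumbersAV] §2.1 Prop. 2.2.

THE OBJECTS (all the tree's).  `Hᵏ(X) = BettiUniverse.hodge hHD hX k`; `Hdgᵖ(H) = H.hodgeClasses p`; `End_HS(H) = HodgeStructure.Hom H H`; `b_k(X) = dim_ℚ Hᵏ(X(ℂ); ℚ) = finrank (bettiCohomology X k)`;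
`ρ(X) = dim_ℚ Hdg¹(H²(X))`, `g(C) = h^{1,0}(C)`; `[HodgeTensorFacts.{0, 0}]`.

WHAT IS PROVED (`X` smooth projective of dimension `n`, any smooth-projective structure `hXX` on `X ⊗ X`).
* §1 THE PIECES: for `i + t = n`, `m = i + 2t`: **`dim Hdgⁿ(Hⁱ(X) ⊗ Hᵐ(X)) = dim End_HS(Hⁱ(X)) = dim Hdgⁿ(Hᵐ(X) ⊗ Hⁱ(X))`** (`BettiUniverse.finrank_hodgeClasses_tensor_hodge_below_above_eq_finrank_hom_self`,
  `…_above_below_…`).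
* §2 THE COUNT: **`dim_ℚ Hdgⁿ(H^{2n}(X ⊗ X)) = Σ_{(i,j), i+j=2n} dim End_HS(H^{min(i,j)}(X))`** (`BettiUniverse.finrank_hodgeClasses_hodge_middle_tensor_self_eq_sum`) **`= dim End_HS(Hⁿ(X)) +
  2 Σ_{k<n} dim End_HS(Hᵏ(X))`** (`…_eq_add_two_mul_sum`; the elementary `sum_antidiagonal_two_mul_min`).
* §3 THE KÜNNETH COMPONENTS OF THE DIAGONAL AS A LOWER BOUND: **`#{(i,j) : i + j = 2n, b_i(X) ≠ 0} ≤ dim_ℚ Hdgⁿ(H^{2n}(X ⊗ X))`** (`BettiUniverse.card_filter_betti_pos_le_finrank_hodgeClasses_middle_tensor_self`),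
  and **`2n + 1 ≤ dim_ℚ Hdgⁿ(H^{2n}(X ⊗ X))` when no Betti number `b_i(X)`, `i ≤ 2n`, vanishes** (`BettiUniverse.two_mul_add_one_le_finrank_hodgeClasses_middle_tensor_self`; abelian varieties,
  curves of positive genus).
* §4 CURVES: **`ρ(C ⊗ C) = 2 + dim_ℚ End_HS(H¹(C))`** (`= 2 + rk End(J(C))`; `BettiUniverse.picardNumber_tensor_curve_self`), `3 ≤ ρ(C ⊗ C)` iff `g(C) ≠ 0` (`BettiUniverse.three_le_picardNumber_tensor_curve_self_iff`).
* §5 EXCEPTIONAL CLASSES IN THE MIDDLE DEGREE: **`Σ_{a+b=n} dim Hdgᵃ(X) dim Hdgᵇ(X) < dim_ℚ Hdgⁿ(H^{2n}(X ⊗ X))`** as soon as some odd `b_k(X) ≠ 0` (`k ≤ n`;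
  `BettiUniverse.sum_finrank_hodgeClasses_mul_lt_middle_of_odd`) or some `H^{2a}(X)`, `2a ≤ n`, is not of pure type (`…_of_hodgeClasses_ne_top`) — e.g. every `X` with `q(X) ≠ 0` or `p_g(X) ≠ 0`
  (`n ≥ 2`): the criteria "no exceptional Hodge classes" of g27-#1 … g28-#1 never reach the middle degree of such an `X × X`.

DEVIATIONS / SCOPE.  The algebraicity of the `δ_i` (standard conjecture `C(X)`; Kleiman) is not touched; the count is by dimensions (the class `δ_i` itself lives on the tree's complex carriers
`kunnethPiece`, file `KunnethComponentsOfHodgeClasses`, not used here).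

## References
* [VoisinHodgeI2002] C. Voisin, *Hodge Theory and Complex Algebraic Geometry I* (2002) — §11.3.3 Thm. 11.38 (p. 285), Thm. 11.40, Lemma 11.41 (p. 286), p. 287; §6.2.3 Thm. 6.25; §7.1.2.
* [Kleiman1968AlgebraicCycles] S. Kleiman, *Algebraic cycles and the Weil conjectures*, in Dix exposés sur la cohomologie des schémas (1968) — §1.4.
* [Arapura2012] D. Arapura, *Algebraic Geometry over the Complex Numbers* (2012) — §11.1 Example 11.1.2 (PDF p. 174).
* [HulekLaface2019PicardNumbersAV] K. Hulek, R. Laface, *On the Picard numbers of abelian varieties*, Ann. Sc. Norm. Super. Pisa (2019) — §2.1 Prop. 2.2.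

## Provenance
Lane `lit-hodgefound` (Hodge path, Track 2), prover seat `lit-hodgefound-p29` (generation 28), self-proposed row g28-#3 (sequel of g28-#1 and g28-#2).
-/

noncomputable section

open scoped TensorProduct
open CategoryTheory MonoidalCategory Module Finset
open Literature.AlgebraicTopology.SingularHomology
open Literature.Geometry.Kaehler

namespace Literature.AlgebraicGeometry.HodgeTheory

open Literature.AlgebraicGeometry.Motives
open Literature.AlgebraicGeometry.Motives.HodgeStructure

variable {n d : ℕ} {X C : SchemeOver ℂ}

/-! ### §0 Bookkeeping: `Σ_{i+j=2n} g(min(i,j)) = g(n) + 2 Σ_{k<n} g(k)`, and the even pieces plus one odd piece -/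

/-- `Σ_{(i,j), i+j=2n} g(min(i, j)) = g(n) + 2 Σ_{k<n} g(k)`. [folklore] -/
private theorem sum_antidiagonal_two_mul_min (g : ℕ → ℕ) (n : ℕ) :
    ∑ ij ∈ antidiagonal (2 * n), g (min ij.1 ij.2) = g n + 2 * ∑ k ∈ range n, g k := by
  rw [Finset.Nat.sum_antidiagonal_eq_sum_range_succ_mk]
  show ∑ k ∈ range (2 * n + 1), g (min k (2 * n - k)) = _
  rw [show 2 * n + 1 = n + (n + 1) by ring, Finset.sum_range_add]
  have h1 : ∑ k ∈ range n, g (min k (2 * n - k)) = ∑ k ∈ range n, g k :=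
    Finset.sum_congr rfl fun k hk ↦ by rw [Finset.mem_range] at hk; rw [min_eq_left (by omega)]
  have h2 : ∑ x ∈ range (n + 1), g (min (n + x) (2 * n - (n + x))) = ∑ x ∈ range (n + 1), g (n + 1 - 1 - x) :=
    Finset.sum_congr rfl fun x hx ↦ by rw [Finset.mem_range] at hx; rw [min_eq_right (by omega), show 2 * n - (n + x) = n + 1 - 1 - x by omega]
  rw [h1, h2, Finset.sum_range_reflect g (n + 1), Finset.sum_range_succ]
  ring

/-- `f(i₀, j₀) + Σ_{b+c=p} f(2b, 2c) ≤ Σ_{i+j=2p} f(i, j)` for `f ≥ 0` and an ODD piece `(i₀, j₀)`, `i₀ + j₀ = 2p`. [folklore] -/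
private theorem add_sum_antidiagonal_double_le (p : ℕ) (f : ℕ × ℕ → ℕ) {i₀ j₀ : ℕ} (h₀ : i₀ + j₀ = 2 * p) (hi₀ : Odd i₀) :
    f (i₀, j₀) + ∑ bc ∈ antidiagonal p, f (2 * bc.1, 2 * bc.2) ≤ ∑ ij ∈ antidiagonal (2 * p), f ij := by
  classical
  have hinj : Set.InjOn (fun bc : ℕ × ℕ ↦ (2 * bc.1, 2 * bc.2)) ↑(antidiagonal p) := fun x _ y _ h ↦ by
    simp only [Prod.mk.injEq] at h
    exact Prod.ext (by omega) (by omega)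
  rw [← Finset.sum_image hinj]
  have hnot : (i₀, j₀) ∉ (antidiagonal p).image (fun bc : ℕ × ℕ ↦ (2 * bc.1, 2 * bc.2)) := by
    intro h
    obtain ⟨bc, -, hbc⟩ := Finset.mem_image.1 h
    simp only [Prod.mk.injEq] at hbc
    obtain ⟨m, hm⟩ := hi₀
    omega
  rw [← Finset.sum_insert hnot]
  refine Finset.sum_le_sum_of_subset_of_nonneg (fun ij hij ↦ ?_) fun _ _ _ ↦ Nat.zero_le _
  rw [HasAntidiagonal.mem_antidiagonal]
  rcases Finset.mem_insert.1 hij with rfl | hij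
  · exact h₀
  · obtain ⟨bc, hbc, rfl⟩ := Finset.mem_image.1 hij
    rw [HasAntidiagonal.mem_antidiagonal] at hbc
    dsimp only
    omega

/-- `Σ_{b+c=p} f(2b, 2c) ≤ Σ_{i+j=2p} f(i, j)` for `f ≥ 0`. [folklore] -/
private theorem sum_antidiagonal_double_le (p : ℕ) (f : ℕ × ℕ → ℕ) :
    ∑ bc ∈ antidiagonal p, f (2 * bc.1, 2 * bc.2) ≤ ∑ ij ∈ antidiagonal (2 * p), f ij := by
  classical
  have hinj : Set.InjOn (fun bc : ℕ × ℕ ↦ (2 * bc.1, 2 * bc.2)) ↑(antidiagonal p) := fun x _ y _ h ↦ by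
    simp only [Prod.mk.injEq] at h
    exact Prod.ext (by omega) (by omega)
  rw [← Finset.sum_image hinj]
  refine Finset.sum_le_sum_of_subset_of_nonneg (fun ij hij ↦ ?_) fun _ _ _ ↦ Nat.zero_le _
  obtain ⟨bc, hbc, rfl⟩ := Finset.mem_image.1 hij
  rw [HasAntidiagonal.mem_antidiagonal] at hbc
  rw [HasAntidiagonal.mem_antidiagonal]
  dsimp only
  omega

section Middle

variable [HodgeTensorFacts.{0, 0}]

/-! ### §1 The pieces `Hⁱ(X) ⊗ H^{2n−i}(X)` of the middle degree -/

/-- **`dim_ℚ Hdgⁿ(Hⁱ(X) ⊗ Hᵐ(X)) = dim_ℚ End_HS(Hⁱ(X))` for `i + t = n`, `m = i + 2t`** (the piece below ⊗ above the middle: its Hodge classes are the morphisms `Hⁱ(X) → Hᵐ(X)(t)` (Lemma 11.41), and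
`Hᵐ(X)(t) ≅ Hⁱ(X)` by hard Lefschetz; among them `δ_i`, the class of `Id_i`). [cite: VoisinHodgeI2002, §11.3.3 Thm. 11.40, Lemma 11.41 (p. 286), p. 287 and §6.2.3 Thm. 6.25] -/
theorem BettiUniverse.finrank_hodgeClasses_tensor_hodge_below_above_eq_finrank_hom_self (hHD : exists_isReal_hodgeModel) (hX : IsSmoothProjective n X) {i t m : ℕ} (hit : i + t = n)
    (hm : i + 2 * t = m) :
    Module.finrank ℚ ↥(((BettiUniverse.hodge hHD hX i).tensor (BettiUniverse.hodge hHD hX m)).hodgeClasses (n : ℤ)) =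
      Module.finrank ℚ (HodgeStructure.Hom (BettiUniverse.hodge hHD hX i) (BettiUniverse.hodge hHD hX i)) := by
  have hw : (m : ℤ) - 2 * (t : ℤ) = (i : ℤ) := by omega
  have e := BettiUniverse.finrank_hodgeClasses_tensor_hodge_eq_finrank_hom_tateTwist hHD hX hX i m (s := (t : ℤ)) hw
  rw [show ((i : ℕ) : ℤ) + (t : ℤ) = (n : ℤ) by omega] at e
  rw [e]
  exact (BettiUniverse.finrank_hom_hodge_right_eq_of_hardLefschetz hHD hX (BettiUniverse.hodge hHD hX i) hit hm rfl hw).symm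

/-- **`dim_ℚ Hdgⁿ(Hᵐ(X) ⊗ Hⁱ(X)) = dim_ℚ End_HS(Hⁱ(X))` for `i + t = n`, `m = i + 2t`** (the piece above ⊗ below the middle: the morphisms `Hᵐ(X) → Hⁱ(X)(−t)`, and `Hᵐ(X) ≅ Hⁱ(X)(−t)`).
[cite: VoisinHodgeI2002, §11.3.3 Thm. 11.40, Lemma 11.41 (p. 286), p. 287 and §6.2.3 Thm. 6.25] -/
theorem BettiUniverse.finrank_hodgeClasses_tensor_hodge_above_below_eq_finrank_hom_self (hHD : exists_isReal_hodgeModel) (hX : IsSmoothProjective n X) {i t m : ℕ} (hit : i + t = n)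
    (hm : i + 2 * t = m) :
    Module.finrank ℚ ↥(((BettiUniverse.hodge hHD hX m).tensor (BettiUniverse.hodge hHD hX i)).hodgeClasses (n : ℤ)) =
      Module.finrank ℚ (HodgeStructure.Hom (BettiUniverse.hodge hHD hX i) (BettiUniverse.hodge hHD hX i)) := by
  have hw : (i : ℤ) - 2 * -(t : ℤ) = (m : ℤ) := by omega
  have e := BettiUniverse.finrank_hodgeClasses_tensor_hodge_eq_finrank_hom_tateTwist hHD hX hX m i (s := -(t : ℤ)) hw
  rw [show ((m : ℕ) : ℤ) + -(t : ℤ) = (n : ℤ) by omega] at e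
  rw [e]
  exact (BettiUniverse.finrank_hom_hodge_left_eq_of_hardLefschetz hHD hX (BettiUniverse.hodge hHD hX i) hit hm rfl hw).symm

/-! ### §2 The count -/

/-- **`dim_ℚ Hdgⁿ(H^{2n}(X ⊗ X)) = Σ_{(i,j), i+j=2n} dim_ℚ End_HS(H^{min(i,j)}(X))`** (Künneth, Thm. 11.40 / Lemma 11.41 piece by piece, hard Lefschetz on the factor above the middle).
[cite: VoisinHodgeI2002, §11.3.3 Thm. 11.38, Thm. 11.40, Lemma 11.41 (pp. 285–286), p. 287 and §6.2.3 Thm. 6.25] -/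
theorem BettiUniverse.finrank_hodgeClasses_hodge_middle_tensor_self_eq_sum (hHD : exists_isReal_hodgeModel) (hX : IsSmoothProjective n X) (hXX : IsSmoothProjective d (X ⊗ X)) :
    Module.finrank ℚ ↥((BettiUniverse.hodge hHD hXX (2 * n)).hodgeClasses n) =
      ∑ ij ∈ antidiagonal (2 * n), Module.finrank ℚ (HodgeStructure.Hom (BettiUniverse.hodge hHD hX (min ij.1 ij.2)) (BettiUniverse.hodge hHD hX (min ij.1 ij.2))) := by
  rw [BettiUniverse.finrank_hodgeClasses_hodge_tensor_eq_sum' hHD hX hX hXX (2 * n) (n : ℤ)]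
  refine Finset.sum_congr rfl fun ij hij ↦ ?_
  rw [HasAntidiagonal.mem_antidiagonal] at hij
  rcases le_or_gt ij.1 n with h | h
  · rw [min_eq_left (by omega : ij.1 ≤ ij.2)]
    exact BettiUniverse.finrank_hodgeClasses_tensor_hodge_below_above_eq_finrank_hom_self hHD hX (i := ij.1) (t := n - ij.1) (m := ij.2) (by omega) (by omega)
  · rw [min_eq_right (by omega : ij.2 ≤ ij.1)]
    exact BettiUniverse.finrank_hodgeClasses_tensor_hodge_above_below_eq_finrank_hom_self hHD hX (i := ij.2) (t := n - ij.2) (m := ij.1) (by omega) (by omega)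

/-- **`dim_ℚ Hdgⁿ(H^{2n}(X ⊗ X)) = dim_ℚ End_HS(Hⁿ(X)) + 2 Σ_{k<n} dim_ℚ End_HS(Hᵏ(X))`** (the symmetric form of the count). [cite: VoisinHodgeI2002, §11.3.3 Thm. 11.40, Lemma 11.41 (p. 286), p. 287 and §6.2.3 Thm. 6.25] -/
theorem BettiUniverse.finrank_hodgeClasses_hodge_middle_tensor_self_eq_add_two_mul_sum (hHD : exists_isReal_hodgeModel) (hX : IsSmoothProjective n X) (hXX : IsSmoothProjective d (X ⊗ X)) :
    Module.finrank ℚ ↥((BettiUniverse.hodge hHD hXX (2 * n)).hodgeClasses n) =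
      Module.finrank ℚ (HodgeStructure.Hom (BettiUniverse.hodge hHD hX n) (BettiUniverse.hodge hHD hX n)) +
        2 * ∑ k ∈ range n, Module.finrank ℚ (HodgeStructure.Hom (BettiUniverse.hodge hHD hX k) (BettiUniverse.hodge hHD hX k)) := by
  rw [BettiUniverse.finrank_hodgeClasses_hodge_middle_tensor_self_eq_sum hHD hX hXX]
  exact sum_antidiagonal_two_mul_min (fun k ↦ Module.finrank ℚ (HodgeStructure.Hom (BettiUniverse.hodge hHD hX k) (BettiUniverse.hodge hHD hX k))) n

/-! ### §3 The Künneth components of the diagonal as a lower bound -/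

/-- **`#{(i, j) : i + j = 2n, b_i(X) ≠ 0} ≤ dim_ℚ Hdgⁿ(H^{2n}(X ⊗ X))`**: every non-zero `Hⁱ(X)` contributes `δ_i` («the morphisms … `Id_k` … provide Hodge classes `δ_k` of degree `2n` on `X × X`»;
`b_{2n−i} = b_i` by Poincaré duality). [cite: VoisinHodgeI2002, §11.3.3 p. 287] [cite: Kleiman1968AlgebraicCycles, §1.4] -/
theorem BettiUniverse.card_filter_betti_pos_le_finrank_hodgeClasses_middle_tensor_self (hHD : exists_isReal_hodgeModel) (hX : IsSmoothProjective n X) (hXX : IsSmoothProjective d (X ⊗ X)) :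
    ((antidiagonal (2 * n)).filter fun ij ↦ 0 < Module.finrank ℚ (bettiCohomology X ij.1)).card ≤ Module.finrank ℚ ↥((BettiUniverse.hodge hHD hXX (2 * n)).hodgeClasses n) := by
  rw [BettiUniverse.finrank_hodgeClasses_hodge_middle_tensor_self_eq_sum hHD hX hXX, Finset.card_filter]
  refine Finset.sum_le_sum fun ij hij ↦ ?_
  rw [HasAntidiagonal.mem_antidiagonal] at hij
  split_ifs with hpos
  · haveI := BettiUniverse.finite hX (min ij.1 ij.2)
    refine BettiUniverse.one_le_finrank_hom_hodge_self hHD hX ((Module.finrank_pos_iff (R := ℚ)).1 ?_)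
    rcases le_or_gt ij.1 n with h | h
    · rwa [min_eq_left (by omega : ij.1 ≤ ij.2)]
    · rwa [min_eq_right (by omega : ij.2 ≤ ij.1), ← BettiUniverse.finrank_bettiCohomology_eq_of_add_eq hX (k := ij.1) (l := ij.2) (by omega)]
  · exact Nat.zero_le _

/-- **`2n + 1 ≤ dim_ℚ Hdgⁿ(H^{2n}(X ⊗ X))` when `b_i(X) ≠ 0` for all `i ≤ 2n`** (all `2n + 1` Künneth components `δ_i` are non-zero: abelian varieties, curves of positive genus, …).
[cite: VoisinHodgeI2002, §11.3.3 p. 287] [cite: Kleiman1968AlgebraicCycles, §1.4] -/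
theorem BettiUniverse.two_mul_add_one_le_finrank_hodgeClasses_middle_tensor_self (hHD : exists_isReal_hodgeModel) (hX : IsSmoothProjective n X) (hXX : IsSmoothProjective d (X ⊗ X))
    (hb : ∀ i ≤ 2 * n, 0 < Module.finrank ℚ (bettiCohomology X i)) :
    2 * n + 1 ≤ Module.finrank ℚ ↥((BettiUniverse.hodge hHD hXX (2 * n)).hodgeClasses n) := by
  refine le_trans ?_ (BettiUniverse.card_filter_betti_pos_le_finrank_hodgeClasses_middle_tensor_self hHD hX hXX)
  rw [Finset.filter_true_of_mem fun ij hij ↦ hb ij.1 (by rw [HasAntidiagonal.mem_antidiagonal] at hij; omega), Finset.Nat.card_antidiagonal]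

/-! ### §4 Curves: `ρ(C × C) = 2 + dim End_HS(H¹(C))` -/

/-- **`ρ(C ⊗ C) = 2 + dim_ℚ End_HS(H¹(C))`** (`= 2 + rk End(J(C))`: the fibres and the graphs of the endomorphisms, among them the diagonal).
[cite: Arapura2012, §11.1 Example 11.1.2 (PDF p. 174)] [cite: HulekLaface2019PicardNumbersAV, §2.1 Prop. 2.2] [cite: VoisinHodgeI2002, §11.3.3 Lemma 11.41 (p. 286) and p. 287] -/
theorem BettiUniverse.picardNumber_tensor_curve_self (hHD : exists_isReal_hodgeModel) (hC : IsSmoothProjective 1 C) (hCC : IsSmoothProjective d (C ⊗ C)) :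
    Module.finrank ℚ ↥((BettiUniverse.hodge hHD hCC 2).hodgeClasses 1) = 2 + Module.finrank ℚ (HodgeStructure.Hom (BettiUniverse.hodge hHD hC 1) (BettiUniverse.hodge hHD hC 1)) :=
  BettiUniverse.picardNumber_tensor_curves_eq_two_add_finrank_hom hHD hC hC hCC

/-- **`3 ≤ ρ(C ⊗ C)` iff `g(C) ≠ 0`** (the class of the diagonal is independent of the two fibre classes exactly when `H¹(C) ≠ 0`). [cite: Arapura2012, §11.1 Example 11.1.2 (PDF p. 174)]
[cite: VoisinHodgeI2002, §11.3.3 p. 287] -/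
theorem BettiUniverse.three_le_picardNumber_tensor_curve_self_iff (hHD : exists_isReal_hodgeModel) (hC : IsSmoothProjective 1 C) (hCC : IsSmoothProjective d (C ⊗ C)) :
    3 ≤ Module.finrank ℚ ↥((BettiUniverse.hodge hHD hCC 2).hodgeClasses 1) ↔ (BettiUniverse.hodge hHD hC 1).hodgeNumber 1 0 ≠ 0 := by
  have h := BettiUniverse.two_mul_picardNumber_lt_picardNumber_tensor_self_iff hHD hC hCC
  rw [BettiUniverse.picardNumber_curve hHD hC] at h
  rw [← h]
  omega

/-! ### §5 The exceptional classes of `X × X` in the middle degree -/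

/-- **`Σ_{a+b=n} dim Hdgᵃ(X)·dim Hdgᵇ(X) < dim_ℚ Hdgⁿ(H^{2n}(X ⊗ X))` when some ODD Betti number `b_k(X)`, `k ≤ n`, is non-zero** (the piece `Hᵏ(X) ⊗ H^{2n−k}(X)` carries `δ_k`, and g27-#1's products only
live on the even pieces) — e.g. every `X` with `q(X) ≠ 0`. [cite: VoisinHodgeI2002, §11.3.3 Thm. 11.38 (p. 285), Lemma 11.41 (p. 286) and p. 287] [cite: Kleiman1968AlgebraicCycles, §1.4] -/
theorem BettiUniverse.sum_finrank_hodgeClasses_mul_lt_middle_of_odd (hHD : exists_isReal_hodgeModel) (hX : IsSmoothProjective n X) (hXX : IsSmoothProjective d (X ⊗ X)) {k : ℕ} (hk : Odd k)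
    (hkn : k ≤ n) (hb : Nontrivial (bettiCohomology X k)) :
    ∑ ab ∈ antidiagonal n, Module.finrank ℚ ↥((BettiUniverse.hodge hHD hX (2 * ab.1)).hodgeClasses ab.1) * Module.finrank ℚ ↥((BettiUniverse.hodge hHD hX (2 * ab.2)).hodgeClasses ab.2) <
      Module.finrank ℚ ↥((BettiUniverse.hodge hHD hXX (2 * n)).hodgeClasses n) := by
  rw [BettiUniverse.finrank_hodgeClasses_hodge_tensor_eq_sum' hHD hX hX hXX (2 * n) (n : ℤ)]
  have h1 : 1 ≤ Module.finrank ℚ ↥(((BettiUniverse.hodge hHD hX k).tensor (BettiUniverse.hodge hHD hX (2 * n - k))).hodgeClasses (n : ℤ)) := by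
    rw [BettiUniverse.finrank_hodgeClasses_tensor_hodge_below_above_eq_finrank_hom_self hHD hX (i := k) (t := n - k) (m := 2 * n - k) (by omega) (by omega)]
    exact BettiUniverse.one_le_finrank_hom_hodge_self hHD hX hb
  have h2 := add_sum_antidiagonal_double_le n (fun ij ↦ Module.finrank ℚ ↥(((BettiUniverse.hodge hHD hX ij.1).tensor (BettiUniverse.hodge hHD hX ij.2)).hodgeClasses (n : ℤ)))
    (by omega : k + (2 * n - k) = 2 * n) hk
  have h3 : ∑ ab ∈ antidiagonal n, Module.finrank ℚ ↥((BettiUniverse.hodge hHD hX (2 * ab.1)).hodgeClasses ab.1) * Module.finrank ℚ ↥((BettiUniverse.hodge hHD hX (2 * ab.2)).hodgeClasses ab.2) ≤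
      ∑ ab ∈ antidiagonal n, Module.finrank ℚ ↥(((BettiUniverse.hodge hHD hX (2 * ab.1)).tensor (BettiUniverse.hodge hHD hX (2 * ab.2))).hodgeClasses (n : ℤ)) := by
    refine Finset.sum_le_sum fun ab hab ↦ ?_
    haveI := BettiUniverse.finite hX (2 * ab.1)
    haveI := BettiUniverse.finite hX (2 * ab.2)
    have h := HodgeStructure.finrank_hodgeClasses_mul_le_finrank_hodgeClasses_tensor (BettiUniverse.hodge hHD hX (2 * ab.1)) (BettiUniverse.hodge hHD hX (2 * ab.2)) (ab.1 : ℤ) (ab.2 : ℤ)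
    rw [HasAntidiagonal.mem_antidiagonal] at hab
    rwa [show ((ab.1 : ℤ) + (ab.2 : ℤ)) = (n : ℤ) by exact_mod_cast hab] at h
  dsimp only at h2
  omega

/-- **`Σ_{a+b=n} dim Hdgᵃ(X)·dim Hdgᵇ(X) < dim_ℚ Hdgⁿ(H^{2n}(X ⊗ X))` when some `H^{2a}(X)`, `2a ≤ n`, is not of pure type `(a, a)`** (the piece `H^{2a}(X) ⊗ H^{2n−2a}(X)` carries
`dim End_HS(H^{2a}(X)) > (dim Hdgᵃ(X))² = dim Hdgᵃ(X)·dim Hdg^{n−a}(X)` classes, g28-#2 and hard Lefschetz on Hodge classes) — e.g. every `X` of dimension `≥ 2` with `p_g(X) ≠ 0`.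
[cite: VoisinHodgeI2002, §11.3.3 Thm. 11.38 (p. 285), Lemma 11.41 (p. 286), p. 287 and §6.2.3 Thm. 6.25] [cite: Kleiman1968AlgebraicCycles, §1.4] -/
theorem BettiUniverse.sum_finrank_hodgeClasses_mul_lt_middle_of_hodgeClasses_ne_top (hHD : exists_isReal_hodgeModel) (hX : IsSmoothProjective n X) (hXX : IsSmoothProjective d (X ⊗ X))
    {a : ℕ} (han : 2 * a ≤ n) (hW : (BettiUniverse.hodge hHD hX (2 * a)).hodgeClasses a ≠ ⊤) :
    ∑ ab ∈ antidiagonal n, Module.finrank ℚ ↥((BettiUniverse.hodge hHD hX (2 * ab.1)).hodgeClasses ab.1) * Module.finrank ℚ ↥((BettiUniverse.hodge hHD hX (2 * ab.2)).hodgeClasses ab.2) <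
      Module.finrank ℚ ↥((BettiUniverse.hodge hHD hXX (2 * n)).hodgeClasses n) := by
  rw [BettiUniverse.finrank_hodgeClasses_hodge_tensor_eq_sum' hHD hX hX hXX (2 * n) (n : ℤ)]
  refine lt_of_lt_of_le ?_ (sum_antidiagonal_double_le n
    (fun ij ↦ Module.finrank ℚ ↥(((BettiUniverse.hodge hHD hX ij.1).tensor (BettiUniverse.hodge hHD hX ij.2)).hodgeClasses (n : ℤ))))
  refine Finset.sum_lt_sum (fun ab hab ↦ ?_) ⟨(a, n - a), HasAntidiagonal.mem_antidiagonal.2 (by omega), ?_⟩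
  · haveI := BettiUniverse.finite hX (2 * ab.1)
    haveI := BettiUniverse.finite hX (2 * ab.2)
    have h := HodgeStructure.finrank_hodgeClasses_mul_le_finrank_hodgeClasses_tensor (BettiUniverse.hodge hHD hX (2 * ab.1)) (BettiUniverse.hodge hHD hX (2 * ab.2)) (ab.1 : ℤ) (ab.2 : ℤ)
    rw [HasAntidiagonal.mem_antidiagonal] at hab
    rw [show ((ab.1 : ℤ) + (ab.2 : ℤ)) = (n : ℤ) by exact_mod_cast hab] at h
    exact h
  · dsimp only
    rw [BettiUniverse.finrank_hodgeClasses_tensor_hodge_below_above_eq_finrank_hom_self hHD hX (i := 2 * a) (t := n - 2 * a) (m := 2 * (n - a)) (by omega) (by omega),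
      ← BettiUniverse.finrank_hodgeClasses_hodge_eq_of_add_eq hHD hX (p := a) (p' := n - a) (by omega)]
    exact BettiUniverse.finrank_hodgeClasses_mul_self_lt_finrank_hom_hodge_self hHD hX hW

/-- **Every `X` of dimension `n ≥ 2` with `p_g(X) ≠ 0` has exceptional Hodge classes in the middle degree of `X × X`: `Σ_{a+b=n} dim Hdgᵃ(X)·dim Hdgᵇ(X) < dim_ℚ Hdgⁿ(H^{2n}(X ⊗ X))`**
(the piece `H²(X) ⊗ H^{2n−2}(X)` carries `dim End_HS(H²(X)) > ρ(X)²` classes). [cite: VoisinHodgeI2002, §11.3.3 Thm. 11.38 (p. 285), Lemma 11.41 (p. 286), p. 287 and §6.2.3 Thm. 6.25] -/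
theorem BettiUniverse.sum_finrank_hodgeClasses_mul_lt_middle_of_pg_ne_zero (hHD : exists_isReal_hodgeModel) (hX : IsSmoothProjective n X) (hXX : IsSmoothProjective d (X ⊗ X)) (hn : 2 ≤ n)
    (hpg : (BettiUniverse.hodge hHD hX 2).hodgeNumber 2 0 ≠ 0) :
    ∑ ab ∈ antidiagonal n, Module.finrank ℚ ↥((BettiUniverse.hodge hHD hX (2 * ab.1)).hodgeClasses ab.1) * Module.finrank ℚ ↥((BettiUniverse.hodge hHD hX (2 * ab.2)).hodgeClasses ab.2) <
      Module.finrank ℚ ↥((BettiUniverse.hodge hHD hXX (2 * n)).hodgeClasses n) := by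
  have hW : (BettiUniverse.hodge hHD hX (2 * 1)).hodgeClasses ((1 : ℕ) : ℤ) ≠ ⊤ := by
    rw [ne_eq, show (BettiUniverse.hodge hHD hX (2 * 1)).hodgeClasses ((1 : ℕ) : ℤ) = (BettiUniverse.hodge hHD hX 2).hodgeClasses 1 from rfl,
      BettiUniverse.hodgeClasses_hodge_two_eq_top_iff hHD hX]
    exact hpg
  exact BettiUniverse.sum_finrank_hodgeClasses_mul_lt_middle_of_hodgeClasses_ne_top hHD hX hXX (a := 1) (by omega) hW

end Middle

end Literature.AlgebraicGeometry.HodgeTheory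

end
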